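import Summits.NavierStokesRegularity.NavierStokesRegularity.Theorems.AxisTwistDoorAveragedConeLiouvilleNUDefs
import HarnessLib

/-!
# Nazarov–Uraltseva 2011 §3 over LIPSCHITZ slices — the standing class `NUStandingLip` and the four
# atom texts `Sig.nuLip_*` (texts of record of the T1 programme, cell pub/ns-inputs)

Definitions ONLY (plate (0) of the T1 ports; no theorem is claimed here).  The five declarations below are
VERBATIM the kit `pub/ns-inputs/kits/N4-T1-skeleton.lean` (ns-in-ser-b g2, sha16 118454bf17607d1e, l.56–138):
`NUStandingLip` = the tree's `NUStanding` (`…Theorems.AxisTwistDoorAveragedConeLiouvilleNUDefs`, p629795) with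
the slice clause `∀ᵐ t ∈ ]-R²,0[, ContDiff ℝ 1 (Φ t)` replaced by «all slices are `L`-Lipschitz for one `L`»
(the energy class `NUEnergyClass` unchanged), and the four De Giorgi atom texts M1ᴸ `Sig.nuLip_moserStep`,
L31ᴸ `Sig.nuLip_smallSublevel_lowerBound`, L32ᴸ `Sig.nuLip_densityPropagation`, L33ᴸ `Sig.nuLip_shrinking`
(= the landed classical texts `Sig.nu_*` with `NUStanding ↦ NUStandingLip`).  Landed as one defs file on the
arbiter's ruling (plan g6, pub/ns-inputs/STATUS 2026-08-28T13:51:22Z: «ONE DEFS FILE for T1») so that the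
port seats (ns-s29-p2 g4: M1ᴸ; ns-qj-p1 g3: L33ᴸ) prove `theorem … : Sig.nuLip_… := …` BY NAME against the
same tree text; `--supports stmt-NavierStokesRegularity-26889 --as helper`.  Two projection lemmas
(`NUStandingLip.energyClass`, `NUStandingLip.pos`) mirror those of `NUStanding`.

WHAT THIS IS NOT: no Navier–Stokes statement; these are the hypotheses/targets of the re-proof of the INPUT
`NazarovUraltseva2011_positivity_propagation` (N4/T1) over Lipschitz generalized supersolutions; item 26889
(conditional on N3 only) and the summit stay open; nothing is proved or closed by this file.

## References
* A. I. Nazarov, N. N. Ural'tseva, Algebra i Analiz 23:1 (2011) 136–168 = St. Petersburg Math. J.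
  23 (2012) 93–115, arXiv:1011.1888, §3 (Lemmata 3.1–3.3). [cite: NazarovUraltseva2011HarnackDivFree, §3 (arXiv pp. 8–10)]
* Z. Lei, X. Ren, G. Tian, arXiv:2501.08976, Lemma 2.5. [cite: LeiRenTian2025, Lemma 2.5]
-/

noncomputable section

-- the summit and its single sub-problem share the name (CONVENTIONS §1)
set_option linter.dupNamespace false

open MeasureTheory Set Function Metric
open scoped NNReal ENNReal InnerProductSpace

namespace Summit.NavierStokesRegularity.NavierStokesRegularity.Theorems.AveragedConeLiouville.NUPositivity


/-- **Standing hypotheses with LIPSCHITZ slices**: `NUStanding` with the clause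
`∀ᵐ t ∈ ]-R²,0[, ContDiff ℝ 1 (Φ t)` replaced by «all slices are `L`-Lipschitz for one `L`»
(the energy class `NUEnergyClass` is unchanged: `gradient (Φ t) x` exists a.e. by Rademacher). -/
def NUStandingLip (Φ : ℝ → EuclideanSpace ℝ (Fin 3) → ℝ)
    (U : ℝ → EuclideanSpace ℝ (Fin 3) → EuclideanSpace ℝ (Fin 3)) (k R : ℝ) (N : ℝ≥0) : Prop :=
  0 < k ∧ 0 < R ∧ Measurable (uncurry Φ) ∧ AEStronglyMeasurable (uncurry U) volume ∧
  ContinuousOn (uncurry Φ) {z : ℝ × EuclideanSpace ℝ (Fin 3) | z.1 < 0} ∧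
  (∀ t x, 0 ≤ Φ t x) ∧
  (∃ L : ℝ≥0, ∀ t, LipschitzWith L (Φ t)) ∧
  (∫⁻ s in Ioo (-R ^ 2) 0, (∫⁻ y in ball (0 : EuclideanSpace ℝ (Fin 3)) (2 * R),
      ‖U s y‖ₑ ^ (3 : ℕ)) ^ (4 / 3 : ℝ) ≤ (N : ℝ≥0∞) * ENNReal.ofReal R ^ 2) ∧
  NUEnergyClass Φ U k R

/-! ### The four atoms over Lipschitz slices (A1/N4 texts, `NUStanding ↦ NUStandingLip`) -/

/-- M1ᴸ. -/
def Sig.nuLip_moserStep : Prop :=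
    ∀ (N : ℝ≥0) (Θmax : ℝ), 0 < Θmax →
    ∃ C₀ A : ℝ, 0 ≤ C₀ ∧ 0 ≤ A ∧
    ∀ (Φ : ℝ → EuclideanSpace ℝ (Fin 3) → ℝ) (U : ℝ → EuclideanSpace ℝ (Fin 3) → EuclideanSpace ℝ (Fin 3)) (k R : ℝ),
      NUStandingLip Φ U k R N →
    ∀ (ρ Λ₁ Λ₂ Θ₁ Θ₂ dl dθ t₀ l q : ℝ), R / 4 ≤ ρ → 1 ≤ Λ₂ → Λ₂ + dl ≤ Λ₁ → Λ₁ * ρ ≤ 2 * R →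
      0 < dl → dl ≤ 1 → 0 < Θ₂ → Θ₂ + dθ ≤ Θ₁ → Θ₁ ≤ Θmax → 0 < dθ → dθ ≤ 1 →
      t₀ ≤ 0 → -R ^ 2 < t₀ - Θ₁ * ρ ^ 2 → 0 < l → l ≤ k → 2 < q →
      (∫⁻ z in Ioo (t₀ - Θ₂ * ρ ^ 2) t₀ ×ˢ ball (0 : EuclideanSpace ℝ (Fin 3)) (Λ₂ * ρ),
          ENNReal.ofReal (max (l - Φ z.1 z.2) 0 ^ (5 / 3 * q))
        ≤ ENNReal.ofReal (C₀ * (dl * dθ) ^ (-A) * ρ ^ (-(10 / 3 : ℝ))) *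
          (∫⁻ z in Ioo (t₀ - Θ₁ * ρ ^ 2) t₀ ×ˢ ball (0 : EuclideanSpace ℝ (Fin 3)) (Λ₁ * ρ),
            ENNReal.ofReal (max (l - Φ z.1 z.2) 0 ^ q)) ^ (5 / 3 : ℝ)) ∧
      ((∀ᵐ x ∂(volume.restrict (ball (0 : EuclideanSpace ℝ (Fin 3)) (Λ₁ * ρ))), l ≤ Φ (t₀ - Θ₁ * ρ ^ 2) x) →
        ∫⁻ z in Ioo (t₀ - Θ₁ * ρ ^ 2) t₀ ×ˢ ball (0 : EuclideanSpace ℝ (Fin 3)) (Λ₂ * ρ),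
            ENNReal.ofReal (max (l - Φ z.1 z.2) 0 ^ (5 / 3 * q))
          ≤ ENNReal.ofReal (C₀ * dl ^ (-A) * ρ ^ (-(10 / 3 : ℝ))) *
            (∫⁻ z in Ioo (t₀ - Θ₁ * ρ ^ 2) t₀ ×ˢ ball (0 : EuclideanSpace ℝ (Fin 3)) (Λ₁ * ρ),
              ENNReal.ofReal (max (l - Φ z.1 z.2) 0 ^ q)) ^ (5 / 3 : ℝ))

/-- L31ᴸ (derived from M1ᴸ by the Moser iteration — the landed `…NUMoserIteration*` proofs port
verbatim, they never touch the slice clause). -/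
def Sig.nuLip_smallSublevel_lowerBound : Prop :=
    ∀ (lamlo θlo θhi : ℝ) (N : ℝ≥0), 1 < lamlo → lamlo ≤ 2 → 0 < θlo → θlo ≤ θhi →
    ∃ μ₁ : ℝ, 0 < μ₁ ∧
    ∀ (Φ : ℝ → EuclideanSpace ℝ (Fin 3) → ℝ) (U : ℝ → EuclideanSpace ℝ (Fin 3) → EuclideanSpace ℝ (Fin 3)) (k R : ℝ),
      NUStandingLip Φ U k R N →
    ∀ (lam ρ θ t₀ l : ℝ), lamlo ≤ lam → lam ≤ 2 → R / 4 ≤ ρ → lam * ρ ≤ 2 * R → θlo ≤ θ → θ ≤ θhi →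
      t₀ ≤ 0 → -R ^ 2 < t₀ - θ * ρ ^ 2 → 0 < l → l ≤ k →
      volume {z : ℝ × EuclideanSpace ℝ (Fin 3) | z ∈ Ioo (t₀ - θ * ρ ^ 2) t₀ ×ˢ ball (0 : EuclideanSpace ℝ (Fin 3)) (lam * ρ) ∧ Φ z.1 z.2 < l}
        ≤ ENNReal.ofReal μ₁ * volume (Ioo (t₀ - θ * ρ ^ 2) t₀ ×ˢ ball (0 : EuclideanSpace ℝ (Fin 3)) (lam * ρ)) →
      (∀ᵐ z ∂(volume.restrict (Ioo (t₀ - θ / 2 * ρ ^ 2) t₀ ×ˢ ball (0 : EuclideanSpace ℝ (Fin 3)) ρ)),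
          l / 2 ≤ Φ z.1 z.2) ∧
      ((∀ᵐ x ∂(volume.restrict (ball (0 : EuclideanSpace ℝ (Fin 3)) (lam * ρ))), l ≤ Φ (t₀ - θ * ρ ^ 2) x) →
        ∀ᵐ z ∂(volume.restrict (Ioo (t₀ - θ * ρ ^ 2) t₀ ×ˢ ball (0 : EuclideanSpace ℝ (Fin 3)) ρ)), l / 2 ≤ Φ z.1 z.2)

/-- L32ᴸ. -/
def Sig.nuLip_densityPropagation : Prop :=
    ∀ (δ₀ : ℝ) (N : ℝ≥0), 0 < δ₀ → δ₀ ≤ 1 →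
    ∃ θ₀ : ℝ, 0 < θ₀ ∧ θ₀ < 1 ∧
    ∀ (Φ : ℝ → EuclideanSpace ℝ (Fin 3) → ℝ) (U : ℝ → EuclideanSpace ℝ (Fin 3) → EuclideanSpace ℝ (Fin 3)) (k R : ℝ),
      NUStandingLip Φ U k R N →
    ∀ (ρ θ t₀ κ : ℝ), R / 4 ≤ ρ → ρ ≤ 2 * R → 0 < θ → θ ≤ θ₀ →
      t₀ ≤ 0 → -R ^ 2 < t₀ - θ * ρ ^ 2 → 0 < κ → κ ≤ k →
      ENNReal.ofReal δ₀ * volume (ball (0 : EuclideanSpace ℝ (Fin 3)) ρ)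
        ≤ volume {x : EuclideanSpace ℝ (Fin 3) | x ∈ ball (0 : EuclideanSpace ℝ (Fin 3)) ρ ∧ κ ≤ Φ (t₀ - θ * ρ ^ 2) x} →
      ∀ t ∈ Icc (t₀ - θ * ρ ^ 2) t₀, t < 0 →
        ENNReal.ofReal (δ₀ / 3) * volume (ball (0 : EuclideanSpace ℝ (Fin 3)) ρ)
          ≤ volume {x : EuclideanSpace ℝ (Fin 3) | x ∈ ball (0 : EuclideanSpace ℝ (Fin 3)) ρ ∧ δ₀ * κ / 3 ≤ Φ t x}

/-- L33ᴸ. -/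
def Sig.nuLip_shrinking : Prop :=
    ∀ (lamlo θlo θhi μ δ₁ : ℝ) (N : ℝ≥0), 1 < lamlo → lamlo ≤ 2 → 0 < θlo → θlo ≤ θhi →
      0 < μ → μ < 1 → 0 < δ₁ →
    ∃ s : ℕ,
    ∀ (Φ : ℝ → EuclideanSpace ℝ (Fin 3) → ℝ) (U : ℝ → EuclideanSpace ℝ (Fin 3) → EuclideanSpace ℝ (Fin 3)) (k R : ℝ),
      NUStandingLip Φ U k R N →
    ∀ (lam ρ θ t₀ κ₀ : ℝ), lamlo ≤ lam → lam ≤ 2 → R / 4 ≤ ρ → lam * ρ ≤ 2 * R → θlo ≤ θ → θ ≤ θhi →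
      t₀ ≤ 0 → -R ^ 2 < t₀ - θ * ρ ^ 2 → 0 < κ₀ → κ₀ ≤ k →
      (∀ᵐ t ∂(volume.restrict (Ioo (t₀ - θ * ρ ^ 2) t₀)),
        ENNReal.ofReal δ₁ * volume (ball (0 : EuclideanSpace ℝ (Fin 3)) ρ)
          ≤ volume {x : EuclideanSpace ℝ (Fin 3) | x ∈ ball (0 : EuclideanSpace ℝ (Fin 3)) ρ ∧ κ₀ ≤ Φ t x}) →
      volume {z : ℝ × EuclideanSpace ℝ (Fin 3) | z ∈ Ioo (t₀ - θ * ρ ^ 2) t₀ ×ˢ ball (0 : EuclideanSpace ℝ (Fin 3)) ρ ∧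
          Φ z.1 z.2 < (2 : ℝ)⁻¹ ^ s * κ₀}
        ≤ ENNReal.ofReal μ * volume (Ioo (t₀ - θ * ρ ^ 2) t₀ ×ˢ ball (0 : EuclideanSpace ℝ (Fin 3)) ρ)

/-- The Lipschitz standing hypotheses give the energy class (projection, for consumers). -/
theorem NUStandingLip.energyClass {Φ : ℝ → EuclideanSpace ℝ (Fin 3) → ℝ}
    {U : ℝ → EuclideanSpace ℝ (Fin 3) → EuclideanSpace ℝ (Fin 3)} {k R : ℝ} {N : ℝ≥0}
    (h : NUStandingLip Φ U k R N) : NUEnergyClass Φ U k R :=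
  h.2.2.2.2.2.2.2.2

/-- The Lipschitz standing hypotheses give `0 < k` and `0 < R` (projection, for consumers). -/
theorem NUStandingLip.pos {Φ : ℝ → EuclideanSpace ℝ (Fin 3) → ℝ}
    {U : ℝ → EuclideanSpace ℝ (Fin 3) → EuclideanSpace ℝ (Fin 3)} {k R : ℝ} {N : ℝ≥0}
    (h : NUStandingLip Φ U k R N) : 0 < k ∧ 0 < R :=
  ⟨h.1, h.2.1⟩

end Summit.NavierStokesRegularity.NavierStokesRegularity.Theorems.AveragedConeLiouville.NUPositivity

end
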